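import Mathlib
import HarnessLib
import HarnessLib.Audit
import Summits.AnomalousDissipation.Statement
import HarnessLib.Audit.Status.Attr

/-!
Route: ResponseTelescope

DORMANT since 2026-08-24T12:47:24Z (reconciler: no traction for 6.8 d (last activity item-evidence-added at 2026-08-17T17:28:54Z); parked, not closed — `ledger route dormant route-AnomalousDissipation-ResponseTelescope --off` to reactiv) — unstaffed, not closed; items shared with open routes are served there. `ledger route dormant <id> --off` reactivates.

Route ResponseTelescope — AnomalousDissipation (Literature.Turb.ZerothLaw); realises idea card
viscosity-halving-response-telescope.

THESIS X (words). Work with exact coherent states: time-periodic classical solutions (u,p) of NS_ν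
on ℝ×T³ with a steady
smooth divergence-free mean-zero force f on the FIRST STOKES SHELL (−Δf = 4π²f: Kolmogorov, ABC, …),
and their period-mean
budgets Ē = ⟨‖u‖₂²⟩ (meanEnergy) and Ī = ν⟨‖∇u‖₂²⟩ (meanDissipation). Two dimensionless numbers of
an orbit:
  r(u) := (νĪ)^{1/2}/Ē  (= √15/(3Re_λ); EXACTLY the relative L²ₜḢ⁻¹ size of the defect −(ν/2)Δu′ by
which a solution u′ of
          NS_{ν/2}(f) fails to solve NS_ν(f) — support item HalvingDefect), and
  β(u) := Ī/Ē^{3/2}     (Kolmogorov's dissipation coefficient εℓ/U³ at ℓ = 1/k_f = 1; laminar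
first-shell states have β = 2πr).
X := HalvingCeiling ∧ EfficientAnchor, where
 • HalvingCeiling (crux, rank 2): for every first-shell f there are C ≥ 0, θ ∈ (0,1] with C(1/250)^θ
≤ (1−(3/4)^θ)/10 such
   that every periodic orbit of NS_ν(f) in the EFFICIENT HIGH-REYNOLDS SCOPE {Ē > 0, β ≥ 1/20, r ≤
1/250} has a partner
   periodic orbit of NS_{ν/2}(f) with |Ē′−Ē| ≤ C r^θ Ē and |Ī′−Ī| ≤ C r^θ Ī (statistical stability
of large-scale budgets
   across ONE viscosity halving, existence direction only, power law in Re_λ⁻¹ — the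
finite-Reynolds-number law of C_ε);
 • EfficientAnchor (crux, rank 3): for SOME first-shell f there is ONE periodic orbit of some
NS_ν(f) with Ē > 0, β ≥ 1/10,
   r ≤ 1/250 (one exact coherent state with turbulent drag at Re_λ ≳ 320; a finite, certifiable
object).
X → AnomalousDissipation: telescope. Starting from the anchor at ν₀, apply the ceiling at ν₀2^{-k}:
the pinned smallness makes
the losses x_k = C r_k^θ summable with Σ x_k ≤ 1/10 and r_{k+1} ≤ (3/4) r_k, so every orbit stays in
scope, Ē_k ≤ (10/9)Ē₀ and
Ī_k ≥ (9/10)Ī₀ > 0 (support item TelescopeArithmetic, pure real analysis); periodic classical ⇒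
global Leray–Hopf by the
DISCHARGED fact Literature.Analysis.FluidPDE.Torus.isGlobalLerayHopf_of_isClassicalNSSolutionOn (as
in the landed
Theorems/CoherentStatesAssembly.lean). ν → 0 is never taken: it is summed.

THESIS X (Lean, one line each; all elaborate rc 0 in Sketch.lean; constants
Literature.Analysis.FunctionSpaces.Torus.{IsSmooth,
IsDivFree,HasZeroMean,laplacian,IsClassicalNSSolutionOn,gradNormSq},
Literature.Analysis.FluidPDE.{meanEnergy,meanDissipation},
Function.Periodic, Real.sqrt, AnomalousDissipation):
HalvingCeiling := ∀ f, IsSmooth f → IsDivFree f → HasZeroMean f → (∀ x, laplacian f x = −((4π²)•f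
x)) → ∃ C θ, 0 ≤ C ∧ 0 < θ ∧
  θ ≤ 1 ∧ C(1/250)^θ ≤ (1−(3/4)^θ)/10 ∧ ∀ ν τ u p, 0<ν → 0<τ → Periodic u τ →
IsClassicalNSSolutionOn univ ν (fun _ ⇒ f) u p →
  0 < Ē u → (1/20)(Ē u)√(Ē u) ≤ Ī ν u → ν·Ī ν u ≤ (1/250)²(Ē u)² → ∃ τ′ u′ p′, 0<τ′ ∧ Periodic u′ τ′
∧
  IsClassicalNSSolutionOn univ (ν/2) (fun _ ⇒ f) u′ p′ ∧ |Ē u′ − Ē u| ≤ C (νĪ/Ē²)^{θ/2} Ē u ∧ |Ī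
(ν/2) u′ − Ī ν u| ≤ C (νĪ/Ē²)^{θ/2} Ī ν u
EfficientAnchor := ∃ f, IsSmooth f ∧ IsDivFree f ∧ HasZeroMean f ∧ (∀ x, laplacian f x = −((4π²)•f
x)) ∧ ∃ ν τ u p, 0<ν ∧ 0<τ ∧
  Periodic u τ ∧ IsClassicalNSSolutionOn univ ν (fun _ ⇒ f) u p ∧ 0 < Ē u ∧ (1/10)(Ē u)√(Ē u) ≤ Ī ν
u ∧ ν·Ī ν u ≤ (1/250)²(Ē u)²
Assembly := HalvingCeiling → EfficientAnchor → AnomalousDissipation   (bodies inlined in the filed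
signature).

Rationale: WHY THIS LINE. It imports dynamical-systems STATISTICAL STABILITY (linear response in its
upper-bound/shadowing form,
Ruelle2009, WangHuBlonigan2014, HairerMajda2009, CarigiKunaBrocker2024; upper semicontinuity of
stationary statistics in
parameters, Wang2009) and PERIODIC-ORBIT THEORY of turbulence (VanVeenKidaKawahara2006,
YasudaGotoKawahara2014,
ChandlerKerswell2013, PageEtAl2024; certified orbits BergBredenLessardVeen2021) into the zeroth law,
with an exact dictionary:
halving ν at fixed f is an autonomous defect −(ν/2)Δu′ whose relative L²ₜḢ⁻¹ size is r =
(νĪ)^{1/2}/Ē = √15/(3Re_λ)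
(HalvingDefect). K41's "independence of ν" becomes a SUMMABILITY statement along ν₀2^{-k}: the
empirical finite-Re law
C_ε = C_ε,∞ + C/R_L (MccombEtAl2015: C = 18.9, C_ε,∞ = 0.468, R_L ≤ 5875, Re_λ ≤ 435;
Sreenivasan1998) gives a per-halving
budget change ≈ 20/R_L ≈ 3.9·10²·r², i.e. C = 1.6, θ = 1 on r ≤ 1/250 — four times inside the pinned
clause
C(1/250)^θ ≤ (1−(3/4)^θ)/10. What is new w.r.t. the card (and answers its audit): (i) the ceiling is
SCOPED to efficient
orbits β = Ī/Ē^{3/2} ≥ 1/20 — without it laminar first-shell states (β = 2πr → 0, r → 0) would be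
admissible anchors and the
ceiling absurd; (ii) everything is dimensionless with PINNED NUMERALS, which is what makes two
honest non-circular cruxes:
with f-dependent thresholds the anchor would have to be a whole family with r → 0, i.e.
CoherentThesis (stmt-0218) again;
with numerals the anchor is ONE orbit at ONE viscosity; (iii) regimes are UPOs, so
realisation/leakage is automatic and
transient (saddle) turbulence is as good as attracting turbulence; (iv) forces restricted to the
first Stokes shell (one
length scale; two-scale forces tuned to k_η would break a pinned ceiling).
RANKED CRUXES. #2 HalvingCeiling — why it might fail: branchwise, short UPOs drift with ν ("the
values given by the short
periodic orbits diverge … decreasing monotonically with viscosity", VanVeenKidaKawahara2006 p.7,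
half the continuations end
at bifurcation points), so the partner is in general a DIFFERENT orbit whose existence near atypical
budgets rests on density
of UPO budgets in the convex budget set of invariant measures (Sigmund1970-type specification) and
on that set not receding
faster than C r^θ — calibrated only on MEAN dissipation; turbulent multistability with diverging
susceptibility exists in
TG/von Kármán geometry (RaveletEtAl2004, CortetEtAl2011) — harmless in the existence direction
unless a whole state is
annihilated within one halving. #3 EfficientAnchor — why it might fail: no UPO with turbulent drag
may exist or be
certifiable at Re_λ ≳ 320: computed NS UPOs reach R_λ ≈ 60–70 (VanVeenKidaKawahara2006;
YasudaGotoKawahara2014), rigorous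
ones are 2-D at ν = 0.265 (BergBredenLessardVeen2021); first-shell 3-D turbulence itself is standard
(BorueOrszag1996,
MusacchioBoffetta2014; ABC unstable beyond R ≈ 13, GallowayFrisch1987, PodviginaPouquet1994).
SUPPORT (provable now): TelescopeToLadder — the telescope's output is LITERALLY
BoussinesqOctaves.BoussinesqLadder
(stmt-AnomalousDissipation-1449) with σ = 1/2: this route and BoussinesqOctaves are the
non-constructive (stability) and
constructive (octave) halves of the same viscosity ladder and share that node; TelescopeArithmetic
(real sequences; constants checked by hand: x ≤ 1/40 ⇒ r′ ≤ (3/4)r, Σx ≤ 1/10,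
Π(1+x) ≤ 10/9, β_k ≥ 0.768β₀); HalvingDefect (algebra on IsClassicalNSSolutionOn +
Green/Cauchy–Schwarz on T³); Assembly
(recursion with Classical.choice + TelescopeArithmetic +
isGlobalLerayHopf_of_isClassicalNSSolutionOn_holds, cf.
Theorems/CoherentStatesAssembly.lean) — the whole glue is staffable today; the import cone has NO
unproved named fact.
KILL CRITERIA. (a) A theorem that first-shell-forced NS on T³ has no periodic classical solution
with β ≥ 1/20, r ≤ 1/250
(a 3-D Marchioro-type attraction result) makes #2 vacuous and #3 false ⇒ close refuted. (b) DNS/UPO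
evidence that per-halving
budget changes of first-shell box turbulence at Re_λ ∈ [320, 650] exceed 2.5 %, or that UPO budget
clouds at ν/2 miss in-scope
budgets at ν by more ⇒ one restate of the numerals (r₀ ↓); a second failure ⇒ close. (c)
¬HalvingCeiling proved ⇒ close
(the telescope has no other engine). (d) #3 proved but #2 refuted ⇒ hand the anchor to
CoherentStates as support.
NOT DECOMPOSED YET. The IFT/Floquet continuation of non-degenerate orbits in ν with the sensitivity
identity
dĪ/dν = ⟨adjoint Floquet mode, Δu⟩ (the linear-response CONTENT of #2 along a branch); a Galerkin or
noise-regularised first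
rung of #2 (Hairer–Majda class); the choice of f and ν₀ for #3 (Kolmogorov vs ABC) and its
certification technology; the
negative ¬HalvingCeiling as a staffed item (refuters may file it). Splits wait for a crux to move
(D-0019).

Novelty: NOVELTY (searched 2026-08-15 BEFORE claiming; local searchd/galaxy intermittently unavailable (rc 75
/ queue saturation),
OpenAlex/S2/arXiv HTTP 429; used: `lit search --source crossref` ("unstable periodic orbits
Kolmogorov flow turbulence";
"Reynolds number dependence dimensionless dissipation rate isotropic turbulence"; "upper
semi-continuity stationary statistical
properties dissipative systems"; "continuous dependence stationary statistical solutions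
Navier-Stokes viscosity parameter";
"multistability memory effect highly turbulent flow"), `lit search --source zbmath` ("unstable
periodic orbits turbulence";
"linear response Navier-Stokes invariant measure"; "periodic orbit measures dense space of invariant
measures specification";
"periodic orbits Navier-Stokes turbulence viscosity continuation" — empty), `lit galaxy search
--star all "unstable periodic
orbit"` and `--star pdf "dimensionless dissipation rate"` (McComb-group papers only), `lit read`
arXiv:1804.00547 pp.5–7,12
and arXiv:1406.6317 pp.2–4,10–11; the card's two novelty audits (15 refs) inherited.)
Nearest prior art actually found: (1) response/statistical-stability CEILINGS for a fixed or
noise-regularised system —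
Ruelle2009 (review), HairerMajda2009 (= doi:10.1088/0951-7715/23/4/008), CarigiKunaBrocker2024
(arXiv:2210.12129, SPDE
response), WangHuBlonigan2014 (least-squares shadowing sensitivities of long-time averages),
Wang2009 (upper semicontinuity
of stationary statistical solutions/long-time statistics  [refs: 10.1088/0951-7715/23/4/008, 1804.00547, 1406.6317, 2210.12129, doi:10.1088/0951-7715/23/4/008, Ruelle2009, HairerMajda2009, CarigiKunaBrocker2024, WangHuBlonigan2014, Wang2009, VanVeenKidaKawahara2006, YasudaGotoKawahara2014, ChandlerKerswell2013, PageEtAl2024, VanVeenVelaMartinKawahara2019, BergBredenLessardVeen2021, MccombEtAl2015, Sreenivasan1998, DoeringFoias2002]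

Barriers (technique_class: statistical-stability response-ceiling upo-budget-telescope): BARRIERS (catalogue Literature/Barriers/AnomalousDissipation, all 18 catalogued decls read
2026-08-15; technique_class: statistical-stability response-ceiling upo-budget-telescope).
Literature.Barriers.AnomalousDissipation.Cheskidov2023_thm13_not_forceRobustNoAnomaly: blocks
force-robust energy-method proofs of NO anomaly (long-time averages); this route is a positive
witness line (UPOs with ε ≥ (9/10)Ī₀), perturbs ν at FIXED f (never the force) and draws no
no-anomaly conclusion — not in the blocked class; Cheskidov's loud ν-dependent families are
instances of, not obstacles to, statistical stability of loud regimes. (The dual defs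
ForceRobustNoAnomaly / ForceRobustNoAnomalyNarrow in the same file are neither used nor attacked.)
Literature.Barriers.AnomalousDissipation.AlexakisDoering2006_energyDissipationBound: in d = 2, β ≲
Re^{-1/2} → 0, so the scope {β ≥ 1/20, r ≤ 1/250} is (asymptotically) EMPTY: the 2-D HalvingCeiling
is vacuous and the 2-D EfficientAnchor false — the telescope correctly proves nothing in 2-D;
witnesses of EfficientAnchor and partners in HalvingCeiling must be genuinely three-dimensional
(x₃-invariant orbits of a first-shell horizontal force inherit the 2-D bound and sit outside the
scope).
Literature.Barriers.AnomalousDissipation.Marchioro1986_globalAttraction: first-shell forcing with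
B(f,f)=0 is globally laminar IN 2-D (mean-zero data; firstMode_* corollaries); our forces ARE
first-shell but on T³ with 3-D dynamics, where ABC flows are linearly unst

Novelty grade: new-combination — ROUTE REVIEW gen-1 (refuter 5830665c, 2026-08-15T13:55Z; 4th pass, CONCUR with 120149d4/3f7689a0/d6c52f0b; deltas only; full text review_RT.txt in my folder). Re-verified: 6 decls rc0; Assembly ↔ (HalvingCeiling → EfficientAnchor → AnomalousDissipation) by Iff.rfl; TelescopeArithmetic constants re-d (refuter refuter-rreview-route-ABC-DefiniteXi-rou-5830665c-0, 2026-08-15T13:49:12Z; prior: arXiv:1804.00547, arXiv:1902.00384, arXiv:1406.6317, doi:10.1088/0951-7715/22/4/009, arXiv:physics/0605090, route-AnomalousDissipation-BoussinesqOctaves)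

History (route lifecycle, newest last):
- 2026-08-24T12:47:24Z · DORMANT — reconciler: no traction for 6.8 d (last activity item-evidence-added at 2026-08-17T17:28:54Z); parked, not closed — `ledger route dormant route-AnomalousDissipa (operator:999:2282063)

sub-problem: AnomalousDissipation · status: dormant · opened planner-plancard-AnomalousDissipation-Anomalo-b79e3d28-0 2026-08-15T11:00:19Z · rev 2 · ledger route-AnomalousDissipation-ResponseTelescope
GENERATED by the gate from the ledger (D-0016/17). Provers cite these decls: `theorem foo : Summit.AnomalousDissipation.AnomalousDissipation.Theses.ResponseTelescope.<Decl> := …` in Summits/AnomalousDissipation/AnomalousDissipation/Theorems/<Name>.lean.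
-/

namespace Summit.AnomalousDissipation.AnomalousDissipation.Theses.ResponseTelescope

open scoped BigOperators Topology Manifold Classical MeasureTheory ProbabilityTheory Matrix InnerProductSpace ComplexConjugate ContinuousMap
open Filter Set Function TopologicalSpace MeasureTheory

attribute [summit_statement] _root_.AnomalousDissipation

open Literature.Turb

/-- item stmt-AnomalousDissipation-2028 · crux · rank 2 · open · by planner
why it might fail: Pinned clause ⇒ EVERY in-scope orbit needs an NS_{ν/2} orbit within 2.5%·(250r)^θ of its budgets; but short-UPO budgets drift monotonically in ν and half the ν-continuations end at bifurcations (VanVeenKidaKawahara2006 p.7), and UPO-budget density near extreme budgets is unproved for NS.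
sources: VanVeenKidaKawahara2006 = arXiv:1804.00547 p.7 (short-UPO ε̄ drifts monotonically in ν; ~half of continuations end in bifurcation), p.6 (ε̄ saturates, R_λ>60), MccombEtAl2015 = arXiv:1406.6317 p.2, p.10 (C_ε = 0.468 + 18.9/R_L, R_L ≤ 5875, R_λ ≤ 435, n = −1.000±0.009: mean law only), Wang2009 doi:10.3934/dcds.2009.23.521 (upper semicontinuity of stationary statistics in a parameter: qualitative, no rate), Ruelle2009 doi:10.1088/0951-7715/22/4/009 (linear response needs hyperbolicity); HairerMajda2009 arXiv:0909.4313; CarigiKunaBrocker2024, Sigmund1970 doi:10.1007/bf01404606 (periodic-orbit measures dense only under specification; unknown for NS), WangHuBlonigan2014 doi:10.1016/j.jcp.2014.03.002 (shadowing sensitivities of long-time averages, assumes shadowability)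
[crux] RESPONSE CEILING ACROSS ONE VISCOSITY HALVING (card T2, scoped and made dimensionless). For
every smooth divergence-free mean-zero force on the first Stokes shell (−Δf = 4π²f) there are C ≥ 0,
θ ∈ (0,1] with C(1/250)^θ ≤ (1−(3/4)^θ)/10 such that every time-periodic classical solution u of
NS_ν(f) on ℝ×T³ in the scope {Ē := meanEnergy u > 0, β := Ī/Ē^{3/2} ≥ 1/20 (drag-coefficient floor;
laminar first-shell states have β = 2πr and are excluded), r := (νĪ)^{1/2}/Ē ≤ 1/250 (r =
√15/(3Re_λ), i.e. Re_λ ≳ 320)}, Ī := meanDissipation ν u, has a PARTNER periodic classical solution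
u′ of NS_{ν/2}(f) (any period) with |Ē′−Ē| ≤ C r^θ Ē and |Ī′−Ī| ≤ C r^θ Ī, where Ī′ =
meanDissipation (ν/2) u′. Existence direction only (upper semicontinuity of the periodic-orbit
budget set under ν ↦ ν/2 with a power-law modulus in Re_λ⁻¹); no claim about 'the' turbulent state,
stability, or continuation of a branch. θ ≤ 1 is WLOG (r ≤ 1/250 < 1). Calibration: the
mean-dissipation law C_ε = 0.468 + 18.9/R_L (MccombEtAl2015 abstract; R_L ≤ 5875, Re_λ ≤ 435;
exponent n = −1.000 ± 0.009) gives a per-halving change ≈ 20/R_L ≈ 3.9·10² r², i.e. C = 1.6, θ = 1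
on the scope — a factor 4 inside the clause; Sreeni -/
@[route_item "route-AnomalousDissipation-ResponseTelescope", crux]
def HalvingCeiling : Prop :=
  ∀ f : UnitAddTorus (Fin 3) → EuclideanSpace ℝ (Fin 3), Literature.Analysis.FunctionSpaces.Torus.IsSmooth f → Literature.Analysis.FunctionSpaces.Torus.IsDivFree f → Literature.Analysis.FunctionSpaces.Torus.HasZeroMean f → (∀ x, Literature.Analysis.FunctionSpaces.Torus.laplacian f x = -((4 * Real.pi ^ 2) • f x)) → ∃ C θ : ℝ, 0 ≤ C ∧ 0 < θ ∧ θ ≤ 1 ∧ C * (1 / 250 : ℝ) ^ θ ≤ (1 - (3 / 4 : ℝ) ^ θ) / 10 ∧ ∀ (ν τ : ℝ) (u : ℝ → UnitAddTorus (Fin 3) → EuclideanSpace ℝ (Fin 3)) (p : ℝ → UnitAddTorus (Fin 3) → ℝ), 0 < ν → 0 < τ → Function.Periodic u τ → Literature.Analysis.FunctionSpaces.Torus.IsClassicalNSSolutionOn Set.univ ν (fun _ => f) u p → 0 < Literature.Analysis.FluidPDE.meanEnergy u → (1 / 20 : ℝ) * (Literature.Analysis.FluidPDE.meanEnergy u *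 Real.sqrt (Literature.Analysis.FluidPDE.meanEnergy u)) ≤ Literature.Analysis.FluidPDE.meanDissipation ν u → ν * Literature.Analysis.FluidPDE.meanDissipation ν u ≤ (1 / 250 : ℝ) ^ 2 * Literature.Analysis.FluidPDE.meanEnergy u ^ 2 → ∃ (τ' : ℝ) (u' : ℝ → UnitAddTorus (Fin 3) → EuclideanSpace ℝ (Fin 3)) (p' : ℝ → UnitAddTorus (Fin 3) → ℝ), 0 < τ' ∧ Function.Periodic u' τ' ∧ Literature.Analysis.FunctionSpaces.Torus.IsClassicalNSSolutionOn Set.univ (ν / 2) (fun _ => f) u' p' ∧ |Literature.Analysis.FluidPDE.meanEnergy u' - Literature.Analysis.FluidPDE.meanEnergy u| ≤ C * (ν * Literature.Analysis.FluidPDE.meanDissipation ν u / Literature.Analysis.FluidPDE.meanEnergy u ^ 2) ^ (θ / 2) * Literature.Analysis.FluidPDE.meanEnergy u ∧ |Literature.Analysis.FluidPDE.meanDissipation (ν / 2) u' - Literature.Analysis.FluidPDE.meanDissipation ν u| ≤ C * (ν * Literature.Analysis.FluidPDE.meanDissipation ν u / Literature.Analysis.FluidPDE.meanEnergy u ^ 2)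 ^ (θ / 2) * Literature.Analysis.FluidPDE.meanDissipation ν u

/-- item stmt-AnomalousDissipation-2029 · crux · rank 3 · open · by planner
why it might fail: May be false or uncertifiable: the 2-D analogue is false (β ≲ Re^{-1/2}, AlexakisDoering2006 barrier) and in 3-D no exact coherent state with turbulent drag is known beyond R_λ = 67 (VanVeenKidaKawahara2006 abstract, p.6); rigorous NS orbits are 2-D at ν = 0.265 (BergBredenLessardVeen2021 p.4).
sources: VanVeenKidaKawahara2006 = arXiv:1804.00547 p.2 (UPOs at R_λ 50–67), p.6 (R_λ = 67 maximal), p.7 (continuation in ν), BergBredenLessardVeen2021 = arXiv:1902.00384 p.4 Thm thm:NS_result (ν = 0.265, orbits 2-D in space on T³), p.28 (ν = 0.286), YasudaGotoKawahara2014 doi:10.1088/0169-5983/46/6/061413 (steady-force periodic-cube turbulence, low R_λ), ParkerSchneider2022 doi:10.1017/jfm.2022.299 (variational UPO search, 2-D Kolmogorov) — crossref search 2026-08-15, no 3-D high-Re certified orbit, decl Literature.Barriers.AnomalousDissipation.AlexakisDoering2006_energyDissipationBound (2-D analogue false: β ≲ Re^{-1/2}), BorueOrszag1996; MusacchioBoffetta2014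 (3-D Kolmogorov turbulence, O(1) drag coefficient in DNS averages only)
[crux] ONE EFFICIENT HIGH-REYNOLDS EXACT COHERENT STATE (card T3, dimensionless). There are a smooth
divergence-free mean-zero first-shell force f on T³ (Kolmogorov a·sin(2πx₂)e₁, ABC, …), a viscosity
ν > 0 and ONE time-periodic classical solution (u,p) of NS_ν(f) on ℝ×T³ with Ē = meanEnergy u > 0, β
= Ī/Ē^{3/2} ≥ 1/10 (turbulent drag: twice the ceiling's floor; box/Kolmogorov turbulence has β ≈
0.3–0.4, laminar first-shell states β = 2πr ≤ 0.025) and r = (νĪ)^{1/2}/Ē ≤ 1/250 (Re_λ ≳ 320). A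
single orbit at a single viscosity — NOT a family with ν → 0 (that would be CoherentStates' target
0218); finite and in principle certifiable (computer-assisted periodic orbit with interval
enclosures of the two period means; period means = limsup means by the proved CesaroMeanPeriodic,
stmt-0514). Equivalent reading: Taylor-type wavenumber (⟨‖∇u‖²⟩/⟨‖u‖²⟩)^{1/2}/(2π) ≥ 25 k_f·(β/0.1)…
i.e. a genuinely multiscale orbit. WHY IT MIGHT FAIL (long form): No exact coherent state with
turbulent drag may exist, or none may be certifiable, at Re_λ ≳ 320 for first-shell forcing:
computed NS UPOs reach R_λ ≈ 60–70 (VanVeenKidaKawahara2006; YasudaGotoKawahara2014) and rigorous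
ones are 2-D at ν = 0.265 (B -/
@[route_item "route-AnomalousDissipation-ResponseTelescope", crux]
def EfficientAnchor : Prop :=
  ∃ f : UnitAddTorus (Fin 3) → EuclideanSpace ℝ (Fin 3), Literature.Analysis.FunctionSpaces.Torus.IsSmooth f ∧ Literature.Analysis.FunctionSpaces.Torus.IsDivFree f ∧ Literature.Analysis.FunctionSpaces.Torus.HasZeroMean f ∧ (∀ x, Literature.Analysis.FunctionSpaces.Torus.laplacian f x = -((4 * Real.pi ^ 2) • f x)) ∧ ∃ (ν τ : ℝ) (u : ℝ → UnitAddTorus (Fin 3) → EuclideanSpace ℝ (Fin 3)) (p : ℝ → UnitAddTorus (Fin 3) → ℝ), 0 < ν ∧ 0 < τ ∧ Function.Periodic u τ ∧ Literature.Analysis.FunctionSpaces.Torus.IsClassicalNSSolutionOn Set.univ ν (fun _ => f) u p ∧ 0 < Literature.Analysis.FluidPDE.meanEnergy u ∧ (1 / 10 : ℝ) * (Literature.Analysis.FluidPDE.meanEnergy u * Real.sqrt (Literature.Analysis.FluidPDE.meanEnergy u)) ≤ Literature.Analysis.FluidPDE.meanDissipation ν u ∧ ν * Literature.Analysis.FluidPDE.meanDissipation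 ν u ≤ (1 / 250 : ℝ) ^ 2 * Literature.Analysis.FluidPDE.meanEnergy u ^ 2

/-- item stmt-AnomalousDissipation-2031 · support · rank 9 · open · by planner
[support] GLUE: HalvingCeiling → EfficientAnchor → BoussinesqLadder, the target of route
BoussinesqOctaves (stmt-AnomalousDissipation-1449, text verbatim) with witnesses ν₀ := anchor
viscosity, σ := 1/2, u n := the n-th telescoped orbit, E := (10/9)·meanEnergy u₀, ε :=
(9/10)·meanDissipation ν₀ u₀. This isolates the telescope (recursion + TelescopeArithmetic) from the
Leray–Hopf bridge; Assembly = this ∘ BoussinesqOctaves.Assembly (stmt-1454) ∘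
isGlobalLerayHopf_of_isClassicalNSSolutionOn_holds. Records formally that the two halving routes
(stability vs construction) share the ladder node. -/
@[route_item "route-AnomalousDissipation-ResponseTelescope", crux]
def TelescopeToLadder : Prop :=
  (∀ f : UnitAddTorus (Fin 3) → EuclideanSpace ℝ (Fin 3), Literature.Analysis.FunctionSpaces.Torus.IsSmooth f → Literature.Analysis.FunctionSpaces.Torus.IsDivFree f → Literature.Analysis.FunctionSpaces.Torus.HasZeroMean f → (∀ x, Literature.Analysis.FunctionSpaces.Torus.laplacian f x = -((4 * Real.pi ^ 2) • f x)) → ∃ C θ : ℝ, 0 ≤ C ∧ 0 < θ ∧ θ ≤ 1 ∧ C * (1 / 250 : ℝ) ^ θ ≤ (1 - (3 / 4 : ℝ) ^ θ) / 10 ∧ ∀ (ν τ : ℝ) (u : ℝ → UnitAddTorus (Fin 3) → EuclideanSpace ℝ (Fin 3)) (p : ℝ → UnitAddTorus (Fin 3) → ℝ), 0 < ν → 0 < τ → Function.Periodic u τ → Literature.Analysis.FunctionSpaces.Torus.IsClassicalNSSolutionOn Set.univ ν (fun _ => f) u p → 0 < Literature.Analysis.FluidPDE.meanEnergy u → (1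 / 20 : ℝ) * (Literature.Analysis.FluidPDE.meanEnergy u * Real.sqrt (Literature.Analysis.FluidPDE.meanEnergy u)) ≤ Literature.Analysis.FluidPDE.meanDissipation ν u → ν * Literature.Analysis.FluidPDE.meanDissipation ν u ≤ (1 / 250 : ℝ) ^ 2 * Literature.Analysis.FluidPDE.meanEnergy u ^ 2 → ∃ (τ' : ℝ) (u' : ℝ → UnitAddTorus (Fin 3) → EuclideanSpace ℝ (Fin 3)) (p' : ℝ → UnitAddTorus (Fin 3) → ℝ), 0 < τ' ∧ Function.Periodic u' τ' ∧ Literature.Analysis.FunctionSpaces.Torus.IsClassicalNSSolutionOn Set.univ (ν / 2) (fun _ => f) u' p' ∧ |Literature.Analysis.FluidPDE.meanEnergy u' - Literature.Analysis.FluidPDE.meanEnergy u| ≤ C * (ν * Literature.Analysis.FluidPDE.meanDissipation ν u / Literature.Analysis.FluidPDE.meanEnergy u ^ 2) ^ (θ / 2) * Literature.Analysis.FluidPDE.meanEnergy u ∧ |Literature.Analysis.FluidPDE.meanDissipation (ν / 2) u' - Literature.Analysis.FluidPDE.meanDissipation ν u| ≤ C * (ν * Literature.Analysis.FluidPDE.meanDissipation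 ν u / Literature.Analysis.FluidPDE.meanEnergy u ^ 2) ^ (θ / 2) * Literature.Analysis.FluidPDE.meanDissipation ν u) → (∃ f : UnitAddTorus (Fin 3) → EuclideanSpace ℝ (Fin 3), Literature.Analysis.FunctionSpaces.Torus.IsSmooth f ∧ Literature.Analysis.FunctionSpaces.Torus.IsDivFree f ∧ Literature.Analysis.FunctionSpaces.Torus.HasZeroMean f ∧ (∀ x, Literature.Analysis.FunctionSpaces.Torus.laplacian f x = -((4 * Real.pi ^ 2) • f x)) ∧ ∃ (ν τ : ℝ) (u : ℝ → UnitAddTorus (Fin 3) → EuclideanSpace ℝ (Fin 3)) (p : ℝ → UnitAddTorus (Fin 3) → ℝ), 0 < ν ∧ 0 < τ ∧ Function.Periodic u τ ∧ Literature.Analysis.FunctionSpaces.Torus.IsClassicalNSSolutionOn Set.univ ν (fun _ => f) u p ∧ 0 < Literature.Analysis.FluidPDE.meanEnergy u ∧ (1 / 10 : ℝ) * (Literature.Analysis.FluidPDE.meanEnergy u * Real.sqrt (Literature.Analysis.FluidPDE.meanEnergy u)) ≤ Literature.Analysis.FluidPDE.meanDissipation ν u ∧ ν * Literature.Analysis.FluidPDE.meanDissipation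 ν u ≤ (1 / 250 : ℝ) ^ 2 * Literature.Analysis.FluidPDE.meanEnergy u ^ 2) → ∃ f : UnitAddTorus (Fin 3) → EuclideanSpace ℝ (Fin 3), Literature.Analysis.FunctionSpaces.Torus.IsSmooth f ∧ Literature.Analysis.FunctionSpaces.Torus.IsDivFree f ∧ Literature.Analysis.FunctionSpaces.Torus.HasZeroMean f ∧ ∃ (ν₀ σ : ℝ) (τ : ℕ → ℝ) (u : ℕ → ℝ → UnitAddTorus (Fin 3) → EuclideanSpace ℝ (Fin 3)) (p : ℕ → ℝ → UnitAddTorus (Fin 3) → ℝ), 0 < ν₀ ∧ 0 < σ ∧ σ < 1 ∧ (∀ n, Literature.Analysis.FunctionSpaces.Torus.IsClassicalNSSolutionOn Set.univ (ν₀ * σ ^ n) (fun _ => f) (u n) (p n) ∧ 0 < τ n ∧ Function.Periodic (u n) (τ n)) ∧ (∃ E : ℝ, ∀ n, Literature.Analysis.FluidPDE.meanEnergy (u n) ≤ E) ∧ ∃ ε : ℝ, 0 < ε ∧ ∀ n, ε ≤ Literature.Analysis.FluidPDE.meanDissipation (ν₀ * σ ^ n) (u n)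

/-- item stmt-AnomalousDissipation-2032 · support · rank 9 · open · by planner
[support] PURE REAL ANALYSIS (card T4), provable now (~200 lines). For C ≥ 0, 0 < θ ≤ 1 with
C(1/250)^θ ≤ (1−(3/4)^θ)/10, and sequences ν,E,I : ℕ → ℝ with ν₀ > 0, ν_{k+1} = ν_k/2, E₀ > 0,
anchor (1/10)E₀√E₀ ≤ I₀, ν₀I₀ ≤ (1/250)²E₀², and the one-step closeness |E_{k+1}−E_k| ≤ x_k E_k,
|I_{k+1}−I_k| ≤ x_k I_k with x_k := C(ν_kI_k/E_k²)^{θ/2} available WHENEVER step k is in scope (E_k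
> 0, (1/20)E_k√E_k ≤ I_k, ν_kI_k ≤ (1/250)²E_k²): then every k is in scope, E_k ≤ (10/9)E₀ and
(9/10)I₀ ≤ I_k. Proof (checked by hand and by adversarial numerics in the planner folder): with q :=
(3/4)^θ ∈ [3/4,1) and s := C(1/250)^θ ≤ (1−q)/10 ≤ 1/40, induct on k carrying r_k² := ν_kI_k/E_k² ≤
(9/16)^k (1/250)²: x_k ≤ s q^k ≤ 1/40; Σ_{j<k} x_j ≤ s/(1−q) ≤ 1/10; Π(1−x_j) ≥ 1 − Σx_j ≥ 9/10 and
Π(1+x_j) ≤ 1/Π(1−x_j) ≤ 10/9 give the E and I bounds; β-scope from (1/20)(10/9)^{3/2} ≤ 9/100;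
r-decay from r_{k+1}² ≤ r_k²(1+x_k)/(2(1−x_k)²) ≤ 0.54 r_k² ≤ (9/16) r_k². Mathlib: Real.rpow
monotonicity (rpow_le_rpow, rpow_natCast, mul_rpow), Finset.prod/sum inequalities (Finset.prod_le_…,
one_sub_sum_le_prod_one_sub not in Mathlib — prove by induction), geometric sums (geom_sum / tsum
not needed: finite sums bounded -/
@[route_item "route-AnomalousDissipation-ResponseTelescope", crux]
def TelescopeArithmetic : Prop :=
  ∀ (C θ : ℝ), 0 ≤ C → 0 < θ → θ ≤ 1 → C * (1 / 250 : ℝ) ^ θ ≤ (1 - (3 / 4 : ℝ) ^ θ) / 10 → ∀ (ν E I : ℕ → ℝ), 0 < ν 0 → (∀ k, ν (k + 1) = ν k / 2) → 0 < E 0 → (1 / 10 : ℝ) * (E 0 * Real.sqrt (E 0)) ≤ I 0 → ν 0 * I 0 ≤ (1 / 250 : ℝ) ^ 2 * E 0 ^ 2 → (∀ k, 0 < E k → (1 / 20 : ℝ) * (E k * Real.sqrt (E k)) ≤ I k → ν k * I k ≤ (1 / 250 : ℝ) ^ 2 * E k ^ 2 → |E (k + 1) - E k| ≤ C * (ν k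 * I k / E k ^ 2) ^ (θ / 2) * E k ∧ |I (k + 1) - I k| ≤ C * (ν k * I k / E k ^ 2) ^ (θ / 2) * I k) → ∀ k, 0 < E k ∧ (1 / 20 : ℝ) * (E k * Real.sqrt (E k)) ≤ I k ∧ ν k * I k ≤ (1 / 250 : ℝ) ^ 2 * E k ^ 2 ∧ E k ≤ (10 / 9 : ℝ) * E 0 ∧ (9 / 10 : ℝ) * I 0 ≤ I k

/-- item stmt-AnomalousDissipation-2033 · support · rank 9 · open · by planner
[support] THE DICTIONARY (card T1), provable now (~80–150 lines). (i) Algebra on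
Torus.IsClassicalNSSolutionOn: a classical solution (u,p) of NS_{ν/2} with force f on ℝ×T³ is a
classical solution of NS_ν with the autonomous defect force f − (ν/2)Δu (the structure has no
smoothness clause on the force; momentum: (ν/2)Δu = νΔu − (ν/2)Δu; other fields verbatim). (ii) The
defect is small only in the energy-dual norm: for smooth v, φ on T³, |∫⟨Δv, φ⟩| ≤ ‖∇v‖₂‖∇φ‖₂
(Green's identity on the torus, cf. the integration by parts used in
Torus.IsClassicalNSSolutionOn.energy_balance / Torus.integral_inner_laplacian_eq_neg if available,
then Cauchy–Schwarz in L²(T³;(ℝ³)³) with Torus.gradNormSq = ∫Σᵢ‖∂ᵢ·‖²). Consequence (informal, not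
part of the item): the period-mean Ḣ⁻¹-size² of the defect of a ν/2-orbit u′ is (ν/2)·Ī′, so its
size relative to Ē′ is exactly r(u′) = √15/(3Re_λ) — the inverse Taylor-Reynolds number IS the
halving defect. Sources: DoeringFoias2002 §2 (energy balance), Frisch1995 Ch. 5. -/
@[route_item "route-AnomalousDissipation-ResponseTelescope", crux]
def HalvingDefect : Prop :=
  (∀ (ν : ℝ) (f u : ℝ → UnitAddTorus (Fin 3) → EuclideanSpace ℝ (Fin 3)) (p : ℝ → UnitAddTorus (Fin 3) → ℝ), Literature.Analysis.FunctionSpaces.Torus.IsClassicalNSSolutionOn Set.univ (ν / 2) f u p → Literature.Analysis.FunctionSpaces.Torus.IsClassicalNSSolutionOn Set.univ ν (fun t x => f t x - (ν / 2) • Literature.Analysis.FunctionSpaces.Torus.laplacian (u t) x) u p) ∧ ∀ (v φ : UnitAddTorus (Fin 3) → EuclideanSpace ℝ (Fin 3)), Literature.Analysis.FunctionSpaces.Torus.IsSmooth v → Literature.Analysis.FunctionSpaces.Torus.IsSmooth φ → |∫ x, ⟪Literature.Analysis.FunctionSpaces.Torus.laplacian v x, φ x⟫_ℝ| ≤ Real.sqrt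 (Literature.Analysis.FunctionSpaces.Torus.gradNormSq v) * Real.sqrt (Literature.Analysis.FunctionSpaces.Torus.gradNormSq φ)

/-- item stmt-AnomalousDissipation-2030 · assembly · rank 1 · open · by planner
[assembly] HalvingCeiling → EfficientAnchor → AnomalousDissipation (bodies inlined). Proof map (≈
250–400 lines, staffable now): from the anchor get f, ν₀, (τ₀,u₀,p₀); from the ceiling at f get C, θ
and the step; build (ν_k, τ_k, u_k, p_k) by Nat.rec with ν_{k+1} = ν_k/2 and, when in scope, the
partner chosen by Classical.choice (else junk); TelescopeArithmetic (support) applied to E_k :=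
meanEnergy u_k, I_k := meanDissipation ν_k u_k shows the scope holds at every k (so the partner
branch was always taken), E_k ≤ (10/9)E₀ and I_k ≥ (9/10)I₀ > 0; this is
BoussinesqOctaves.BoussinesqLadder with σ = 1/2 (support TelescopeToLadder); then ν₀2^{-k} → 0
(tendsto_pow_atTop_nhds_zero_of_lt_one), periodic classical ⇒ IsGlobalLerayHopf from u_k 0 by the
DISCHARGED fact Literature.Analysis.FluidPDE.Torus.isGlobalLerayHopf_of_isClassicalNSSolutionOn
(_holds in TorusClassicalLerayHopfProofs) with isSmoothSpaceTimeOn_const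
(Theorems/CoherentStatesAssembly.lean), clauses of Literature.Turb.ZerothLaw verbatim. No PDE
estimate and no unproved fact in the cone. -/
@[route_item "route-AnomalousDissipation-ResponseTelescope", crux]
def Assembly : Prop :=
  (∀ f : UnitAddTorus (Fin 3) → EuclideanSpace ℝ (Fin 3), Literature.Analysis.FunctionSpaces.Torus.IsSmooth f → Literature.Analysis.FunctionSpaces.Torus.IsDivFree f → Literature.Analysis.FunctionSpaces.Torus.HasZeroMean f → (∀ x, Literature.Analysis.FunctionSpaces.Torus.laplacian f x = -((4 * Real.pi ^ 2) • f x)) → ∃ C θ : ℝ, 0 ≤ C ∧ 0 < θ ∧ θ ≤ 1 ∧ C * (1 / 250 : ℝ) ^ θ ≤ (1 - (3 / 4 : ℝ) ^ θ) / 10 ∧ ∀ (ν τ : ℝ) (u : ℝ → UnitAddTorus (Fin 3) → EuclideanSpace ℝ (Fin 3)) (p : ℝ → UnitAddTorus (Fin 3) → ℝ), 0 < ν → 0 < τ → Function.Periodic u τ → Literature.Analysis.FunctionSpaces.Torus.IsClassicalNSSolutionOn Set.univ ν (fun _ => f) u p → 0 < Literature.Analysis.FluidPDE.meanEnergy u →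 (1 / 20 : ℝ) * (Literature.Analysis.FluidPDE.meanEnergy u * Real.sqrt (Literature.Analysis.FluidPDE.meanEnergy u)) ≤ Literature.Analysis.FluidPDE.meanDissipation ν u → ν * Literature.Analysis.FluidPDE.meanDissipation ν u ≤ (1 / 250 : ℝ) ^ 2 * Literature.Analysis.FluidPDE.meanEnergy u ^ 2 → ∃ (τ' : ℝ) (u' : ℝ → UnitAddTorus (Fin 3) → EuclideanSpace ℝ (Fin 3)) (p' : ℝ → UnitAddTorus (Fin 3) → ℝ), 0 < τ' ∧ Function.Periodic u' τ' ∧ Literature.Analysis.FunctionSpaces.Torus.IsClassicalNSSolutionOn Set.univ (ν / 2) (fun _ => f) u' p' ∧ |Literature.Analysis.FluidPDE.meanEnergy u' - Literature.Analysis.FluidPDE.meanEnergy u| ≤ C * (ν * Literature.Analysis.FluidPDE.meanDissipation ν u / Literature.Analysis.FluidPDE.meanEnergy u ^ 2) ^ (θ / 2) * Literature.Analysis.FluidPDE.meanEnergy u ∧ |Literature.Analysis.FluidPDE.meanDissipation (ν / 2) u' - Literature.Analysis.FluidPDE.meanDissipation ν u| ≤ C * (ν * Literature.Analysis.FluidPDE.meanDissipation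 ν u / Literature.Analysis.FluidPDE.meanEnergy u ^ 2) ^ (θ / 2) * Literature.Analysis.FluidPDE.meanDissipation ν u) → (∃ f : UnitAddTorus (Fin 3) → EuclideanSpace ℝ (Fin 3), Literature.Analysis.FunctionSpaces.Torus.IsSmooth f ∧ Literature.Analysis.FunctionSpaces.Torus.IsDivFree f ∧ Literature.Analysis.FunctionSpaces.Torus.HasZeroMean f ∧ (∀ x, Literature.Analysis.FunctionSpaces.Torus.laplacian f x = -((4 * Real.pi ^ 2) • f x)) ∧ ∃ (ν τ : ℝ) (u : ℝ → UnitAddTorus (Fin 3) → EuclideanSpace ℝ (Fin 3)) (p : ℝ → UnitAddTorus (Fin 3) → ℝ), 0 < ν ∧ 0 < τ ∧ Function.Periodic u τ ∧ Literature.Analysis.FunctionSpaces.Torus.IsClassicalNSSolutionOn Set.univ ν (fun _ => f) u p ∧ 0 < Literature.Analysis.FluidPDE.meanEnergy u ∧ (1 / 10 : ℝ) * (Literature.Analysis.FluidPDE.meanEnergy u * Real.sqrt (Literature.Analysis.FluidPDE.meanEnergy u)) ≤ Literature.Analysis.FluidPDE.meanDissipation ν u ∧ ν * Literature.Analysis.FluidPDE.meanDissipation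 ν u ≤ (1 / 250 : ℝ) ^ 2 * Literature.Analysis.FluidPDE.meanEnergy u ^ 2) → AnomalousDissipation

/-! D-0027 §2.1 — DECIDING THEOREM (planner-authored via `route open/edit --closes-file`; by planner-rbadge-AnomalousDissipation-ResponseTe-d90fab6f-g2-0 2026-08-15T16:12:38Z):
its hypotheses are this route's items and its conclusion the sub-problem Statement (glue_lint), and it elaborates with this file. -/

@[closes "route-AnomalousDissipation-ResponseTelescope"] theorem closes : HalvingCeiling → EfficientAnchor → TelescopeToLadder → TelescopeArithmetic → HalvingDefect → Assembly → _root_.AnomalousDissipation :=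
  fun hCeiling hAnchor _hLadder _hArith _hDefect hAssembly => hAssembly hCeiling hAnchor

end Summit.AnomalousDissipation.AnomalousDissipation.Theses.ResponseTelescope
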